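import Summits.CriticalPhenomena.PercolationContinuityZ3.Theorems.PercNearOneGluingNoHeavyLowerTailSahiCTCLadderThreeRowTwoDense
import Summits.CriticalPhenomena.PercolationContinuityZ3.Theorems.PercNearOneGluingNoHeavyLowerTailSahiCTCKleitmanPinnedT
import HarnessLib

/-!
# `NoHeavyLowerTail` (crux stmt-CriticalPhenomena-4575), P3 lane: pinned-density facts for the row `#dbl = 2` of `(L_3)`

Support file (seat `prim-l12-p3`, gen 26; `--supports stmt-CriticalPhenomena-4575`).  Memo g26 §4.12–4.13.  Profile `m = 2·1_{d} + 2·1_{d'} + 1_T`,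
`n = τ − 1`, counts `a = #{y : D+y ∈ W}`, `q_d = #{Q : d+Q ∈ W}`, `ε = #{E ⊆ T : E ∈ W}`.  Two families of PINNED lower bounds
(`pinnedT_le_kap`), summed over the cubes and double counted:
* `rowTwo_pinned_facts_R`: split a restriction cube `κ(∅, D ∪ U)` at `d'` and pin both pieces at `d`:
  `n(n−1)·Σ κ(∅, d ∪ U) ≥ 2(n−1)·cH(3,n)·q_d + 6(n+1)·ε` and `n·Σ κ({d'}, d ∪ U) ≥ n(n+1)·a + 2·q_{d'}`;
* `rowTwo_pinned_facts_M`: pin the link cube `κ({d'}, d ∪ (T∖Q))` at `d`: `2·Σ_Q κ ≥ n²·a + 2·q_{d'}`.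
Nothing is asserted about the crux.
-/

namespace Summit.CriticalPhenomena.PercolationContinuityZ3.Theorems.SahiCTCForms

open Finset MvPolynomial SahiCTCGenFun SahiCTCWeightedLYM

variable {α : Type*} [DecidableEq α] [Fintype α]

section RowTwoPinned
variable {𝒳 𝒵 : Finset (Finset α)}

omit [Fintype α] in
/-- Pinned common triples of the cube `d ∪ s`: the common `d`-pairs inside `s`. [this work] -/
theorem card_filter_pairs_le_pinned {T s : Finset α} {d : α} (hdT : d ∉ T) :
    #((((T.powersetCard 2).filter fun Q => insert d Q ∈ 𝒳 ∧ insert d Q ∈ 𝒵)).filter fun w => w ⊆ s)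
      ≤ #((csetsT 𝒳 𝒵 ∅ (insert d s) 3).filter fun w => d ∈ w) := by
  refine card_le_card_of_injOn (fun Q => insert d Q) (fun Q hQ => ?_) (fun Q hQ Q' hQ' h => ?_)
  · obtain ⟨hQG, hQs⟩ := mem_filter.1 (Finset.mem_coe.1 hQ)
    obtain ⟨hQ2, hX, hZ⟩ := mem_filter.1 hQG
    obtain ⟨hQT, hQc⟩ := mem_powersetCard.1 hQ2
    refine Finset.mem_coe.2 (mem_filter.2 ⟨mem_csetsT.2 ⟨insert_subset_insert d hQs, ?_, ?_, ?_⟩, mem_insert_self d Q⟩)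
    · rw [card_insert_of_notMem (fun h => hdT (hQT h)), hQc]
    · rw [empty_union]; exact hX
    · rw [empty_union]; exact hZ
  · have hQT := (mem_powersetCard.1 (mem_filter.1 (mem_filter.1 (Finset.mem_coe.1 hQ)).1).1).1
    have hQT' := (mem_powersetCard.1 (mem_filter.1 (mem_filter.1 (Finset.mem_coe.1 hQ')).1).1).1
    have h' : insert d Q = insert d Q' := h
    rw [← erase_insert (fun h => hdT (hQT h)), h', erase_insert (fun h => hdT (hQT' h))]

omit [Fintype α] in
/-- Unpinned common triples of the cube `d ∪ s`: the common triples inside `s`. [this work] -/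
theorem card_filter_triples_le_unpinned {T s : Finset α} {d : α} (hdT : d ∉ T) :
    #((((T.powersetCard 3).filter fun E => E ∈ 𝒳 ∧ E ∈ 𝒵)).filter fun w => w ⊆ s)
      ≤ #((csetsT 𝒳 𝒵 ∅ (insert d s) 3).filter fun w => d ∉ w) := by
  refine card_le_card fun E hE => ?_
  obtain ⟨hEE, hEs⟩ := mem_filter.1 hE
  obtain ⟨hE3, hX, hZ⟩ := mem_filter.1 hEE
  obtain ⟨hET', hEc⟩ := mem_powersetCard.1 hE3
  refine mem_filter.2 ⟨mem_csetsT.2 ⟨hEs.trans (subset_insert d s), hEc, ?_, ?_⟩, fun h => hdT (hET' h)⟩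
  · rw [empty_union]; exact hX
  · rw [empty_union]; exact hZ

omit [Fintype α] in
/-- Pinned common pairs of the link cube `({d'}, d ∪ s)`: the points `y ∈ s` with `{d, d'} + y` common. [this work] -/
theorem card_filter_points_le_pinned {T s D : Finset α} {d d' : α} (hDe : D = {d, d'}) (hdT : d ∉ T) :
    #((((T.powersetCard 1).filter fun Y => D ∪ Y ∈ 𝒳 ∧ D ∪ Y ∈ 𝒵)).filter fun w => w ⊆ s)
      ≤ #((csetsT 𝒳 𝒵 {d'} (insert d s) 2).filter fun w => d ∈ w) := by
  refine card_le_card_of_injOn (fun Y => insert d Y) (fun Y hY => ?_) (fun Y hY Y' hY' h => ?_)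
  · obtain ⟨hYA, hYs⟩ := mem_filter.1 (Finset.mem_coe.1 hY)
    obtain ⟨hY1, hX, hZ⟩ := mem_filter.1 hYA
    obtain ⟨hYT, hYc⟩ := mem_powersetCard.1 hY1
    have e : {d'} ∪ insert d Y = D ∪ Y := by
      rw [hDe]; ext x; simp only [mem_union, mem_insert, mem_singleton]; tauto
    refine Finset.mem_coe.2 (mem_filter.2 ⟨mem_csetsT.2 ⟨insert_subset_insert d hYs, ?_, ?_, ?_⟩, mem_insert_self d Y⟩)
    · rw [card_insert_of_notMem (fun h => hdT (hYT h)), hYc]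
    · rw [e]; exact hX
    · rw [e]; exact hZ
  · have hYT := (mem_powersetCard.1 (mem_filter.1 (mem_filter.1 (Finset.mem_coe.1 hY)).1).1).1
    have hYT' := (mem_powersetCard.1 (mem_filter.1 (mem_filter.1 (Finset.mem_coe.1 hY')).1).1).1
    have h' : insert d Y = insert d Y' := h
    rw [← erase_insert (fun h => hdT (hYT h)), h', erase_insert (fun h => hdT (hYT' h))]

omit [Fintype α] in
/-- Unpinned common pairs of the link cube `({d'}, d ∪ s)`: the common `d'`-pairs inside `s`. [this work] -/
theorem card_filter_pairs_le_unpinned {T s : Finset α} {d d' : α} (hdT : d ∉ T) :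
    #((((T.powersetCard 2).filter fun Q => insert d' Q ∈ 𝒳 ∧ insert d' Q ∈ 𝒵)).filter fun w => w ⊆ s)
      ≤ #((csetsT 𝒳 𝒵 {d'} (insert d s) 2).filter fun w => d ∉ w) := by
  refine card_le_card fun Q hQ => ?_
  obtain ⟨hQG, hQs⟩ := mem_filter.1 hQ
  obtain ⟨hQ2, hX, hZ⟩ := mem_filter.1 hQG
  obtain ⟨hQT, hQc⟩ := mem_powersetCard.1 hQ2
  refine mem_filter.2 ⟨mem_csetsT.2 ⟨hQs.trans (subset_insert d s), hQc, ?_, ?_⟩, fun h => hdT (hQT h)⟩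
  · rw [← insert_eq]; exact hX
  · rw [← insert_eq]; exact hZ

omit [Fintype α] in
/-- **Pinned facts of the RESTRICTION cubes of the row `#dbl = 2`** (`n = τ − 1 ≥ 6`; `dbl m = {d, d'}`): splitting `κ(∅, D ∪ U)` at `d'`
and pinning the deletion (3-live) and the link (2-live) at `d`. [this work] -/
theorem rowTwo_pinned_facts_R (h𝒳 : IsUpperSet (𝒳 : Set (Finset α))) (h𝒵 : IsUpperSet (𝒵 : Set (Finset α)))
    (hX3 : ∀ S ∈ 𝒳, 3 ≤ #S) (hZ3 : ∀ S ∈ 𝒵, 3 ≤ #S) {m : α →₀ ℕ} {d d' : α} (hDe : dbl m = {d, d'}) (hdd' : d ≠ d')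
    {n : ℕ} (hn : #(lev m 1) = n + 1) (hn6 : 6 ≤ n) :
    (∑ Y ∈ (lev m 1).powersetCard 1, kap 𝒳 𝒵 ∅ (insert d (lev m 1 \ Y)) +
        ∑ Y ∈ (lev m 1).powersetCard 1, kap 𝒳 𝒵 {d'} (insert d (lev m 1 \ Y)) ≤
      ∑ Y ∈ (lev m 1).powersetCard 1, kap 𝒳 𝒵 ∅ (dbl m ∪ (lev m 1 \ Y))) ∧
    (2 * ((n : ℤ) - 1) * (cH 3 n : ℤ) * #(((lev m 1).powersetCard 2).filter fun Q => insert d Q ∈ 𝒳 ∧ insert d Q ∈ 𝒵) +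
        6 * ((n : ℤ) + 1) * #(((lev m 1).powersetCard 3).filter fun E => E ∈ 𝒳 ∧ E ∈ 𝒵) ≤
      (n : ℤ) * (n - 1) * ∑ Y ∈ (lev m 1).powersetCard 1, kap 𝒳 𝒵 ∅ (insert d (lev m 1 \ Y))) ∧
    ((n : ℤ) * (n + 1) * #(((lev m 1).powersetCard 1).filter fun Y => dbl m ∪ Y ∈ 𝒳 ∧ dbl m ∪ Y ∈ 𝒵) +
        2 * #(((lev m 1).powersetCard 2).filter fun Q => insert d' Q ∈ 𝒳 ∧ insert d' Q ∈ 𝒵) ≤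
      (n : ℤ) * ∑ Y ∈ (lev m 1).powersetCard 1, kap 𝒳 𝒵 {d'} (insert d (lev m 1 \ Y))) := by
  have hDT : Disjoint (dbl m) (lev m 1) := disjoint_dbl_lev_one m
  have hd : d ∈ dbl m := by rw [hDe]; simp
  have hd' : d' ∈ dbl m := by rw [hDe]; simp
  have hdT : d ∉ lev m 1 := fun h => disjoint_left.1 hDT hd h
  have hd'T : d' ∉ lev m 1 := fun h => disjoint_left.1 hDT hd' h
  set A1 := ((lev m 1).powersetCard 1).filter fun Y => dbl m ∪ Y ∈ 𝒳 ∧ dbl m ∪ Y ∈ 𝒵 with hA1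
  set Qd := ((lev m 1).powersetCard 2).filter fun Q => insert d Q ∈ 𝒳 ∧ insert d Q ∈ 𝒵 with hQd
  set Qd' := ((lev m 1).powersetCard 2).filter fun Q => insert d' Q ∈ 𝒳 ∧ insert d' Q ∈ 𝒵 with hQd'
  set ET := ((lev m 1).powersetCard 3).filter fun E => E ∈ 𝒳 ∧ E ∈ 𝒵 with hET
  have h1n : 1 ≤ n := by omega
  have h2n : 2 ≤ n := by omega
  -- liveness of traces
  have hl3X : ∀ s, ∀ U ∈ tr 𝒳 ∅ s, 3 ≤ #U := fun s U hU => hX3 U (by simpa using (mem_tr.1 hU).2)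
  have hl3Z : ∀ s, ∀ U ∈ tr 𝒵 ∅ s, 3 ≤ #U := fun s U hU => hZ3 U (by simpa using (mem_tr.1 hU).2)
  have hl2X : ∀ s, ∀ U ∈ tr 𝒳 {d'} s, 2 ≤ #U := fun s U hU => by
    have := hX3 _ (mem_tr.1 hU).2; have := card_union_le ({d'} : Finset α) U; rw [card_singleton] at this; omega
  have hl2Z : ∀ s, ∀ U ∈ tr 𝒵 {d'} s, 2 ≤ #U := fun s U hU => by
    have := hZ3 _ (mem_tr.1 hU).2; have := card_union_le ({d'} : Finset α) U; rw [card_singleton] at this; omega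
  have hnY : ∀ Y ∈ (lev m 1).powersetCard 1, #(insert d (lev m 1 \ Y)) = n + 1 := fun Y hY => by
    rw [card_insert_of_notMem (fun h => hdT (mem_sdiff.1 h).1), card_sdiff_of_subset (mem_powersetCard.1 hY).1,
      (mem_powersetCard.1 hY).2]; omega
  have hd'U : ∀ Y, d' ∉ insert d (lev m 1 \ Y) := fun Y h => by
    rcases mem_insert.1 h with h | h
    · exact hdd' h.symm
    · exact hd'T (mem_sdiff.1 h).1
  refine ⟨?_, ?_, ?_⟩
  · -- the split at d'
    rw [← sum_add_distrib]
    refine sum_le_sum fun Y hY => ?_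
    have e : dbl m ∪ (lev m 1 \ Y) = insert d' (insert d (lev m 1 \ Y)) := by
      rw [hDe]; ext x; simp only [mem_union, mem_insert, mem_singleton]; tauto
    have s := kap_add_kap_le_kap_insert h𝒳 h𝒵 (D := (∅ : Finset α)) (s' := insert d (lev m 1 \ Y)) (notMem_empty d') (hd'U Y)
    rw [insert_empty_eq] at s
    rw [e]; exact s
  · -- the deletion pieces, pinned at d (level 3)
    have hP : ∀ Y ∈ (lev m 1).powersetCard 1,
        ((cH 3 n * n.choose 3 : ℕ) : ℤ) * #(Qd.filter fun w => w ⊆ lev m 1 \ Y)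
          + ((cH 2 n * n.choose 2 : ℕ) : ℤ) * #(ET.filter fun w => w ⊆ lev m 1 \ Y)
          ≤ ((n.choose 2 * n.choose 3 : ℕ) : ℤ) * kap 𝒳 𝒵 ∅ (insert d (lev m 1 \ Y)) := fun Y hY => by
      have h := pinnedT_le_kap h𝒳 h𝒵 2 n ∅ (insert d (lev m 1 \ Y)) d (disjoint_empty_left _) (hnY Y hY) (mem_insert_self d _)
        (by omega) (hl3X _) (hl3Z _)
      have h1 := card_filter_pairs_le_pinned (𝒳 := 𝒳) (𝒵 := 𝒵) (s := lev m 1 \ Y) hdT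
      have h2 := card_filter_triples_le_unpinned (𝒳 := 𝒳) (𝒵 := 𝒵) (s := lev m 1 \ Y) hdT
      have m1 := mul_le_mul_of_nonneg_left (show (#(Qd.filter fun w => w ⊆ lev m 1 \ Y) : ℤ)
          ≤ #((csetsT 𝒳 𝒵 ∅ (insert d (lev m 1 \ Y)) 3).filter fun w => d ∈ w) by exact_mod_cast h1)
        (show (0 : ℤ) ≤ ((cH 3 n * n.choose 3 : ℕ) : ℤ) from Nat.cast_nonneg _)
      have m2 := mul_le_mul_of_nonneg_left (show (#(ET.filter fun w => w ⊆ lev m 1 \ Y) : ℤ)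
          ≤ #((csetsT 𝒳 𝒵 ∅ (insert d (lev m 1 \ Y)) 3).filter fun w => d ∉ w) by exact_mod_cast h2)
        (show (0 : ℤ) ≤ ((cH 2 n * n.choose 2 : ℕ) : ℤ) from Nat.cast_nonneg _)
      linarith
    have hQd'' : ∀ w ∈ Qd, w ⊆ lev m 1 ∧ #w = 2 := fun w hw => mem_powersetCard.1 (mem_filter.1 hw).1
    have hET' : ∀ w ∈ ET, w ⊆ lev m 1 ∧ #w = 3 := fun w hw => mem_powersetCard.1 (mem_filter.1 hw).1
    have sP := sum_le_sum hP
    rw [sum_add_distrib, ← mul_sum, ← mul_sum, ← mul_sum] at sP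
    rw [show ∑ x ∈ (lev m 1).powersetCard 1, (#(Qd.filter fun w => w ⊆ lev m 1 \ x) : ℤ) = (#Qd * (#(lev m 1) - 2).choose 1 : ℕ) from by
      exact_mod_cast sum_card_filter_subset_sdiff hQd'' 1] at sP
    rw [show ∑ x ∈ (lev m 1).powersetCard 1, (#(ET.filter fun w => w ⊆ lev m 1 \ x) : ℤ) = (#ET * (#(lev m 1) - 3).choose 1 : ℕ) from by
      exact_mod_cast sum_card_filter_subset_sdiff hET' 1] at sP
    have hcH2 : cH 2 n = n + 1 := by unfold cH; rw [show min 2 (n + 1 - 2) = 2 from by omega]; simp [sum_range_succ]; omega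
    rw [hn, hcH2] at sP
    simp only [Nat.choose_one_right, show n + 1 - 3 = n - 2 from by omega, show n + 1 - 2 = n - 1 from by omega] at sP
    push_cast [Nat.cast_sub h1n, Nat.cast_sub h2n] at sP
    -- binomials
    have e2 : ((n.choose 2 : ℕ) : ℤ) * 2 = (n : ℤ) * (n - 1) := by
      have h2 : n.choose 2 * 2 = n * (n - 1) := by rw [Nat.choose_two_right]; exact Nat.div_mul_cancel (Nat.even_mul_pred_self n).two_dvd
      have := congrArg (fun k : ℕ => (k : ℤ)) h2; push_cast [Nat.cast_sub h1n] at this; linarith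
    have e6 : ((n.choose 3 : ℕ) : ℤ) * 6 = (n : ℤ) * (n - 1) * (n - 2) := by
      have e2' : (((n - 1).choose 2 : ℕ) : ℤ) * 2 = ((n : ℤ) - 1) * (n - 2) := by
        have h2 : (n - 1).choose 2 * 2 = (n - 1) * (n - 1 - 1) := by
          rw [Nat.choose_two_right]; exact Nat.div_mul_cancel (Nat.even_mul_pred_self _).two_dvd
        have := congrArg (fun k : ℕ => (k : ℤ)) h2
        push_cast [Nat.cast_sub h1n, Nat.cast_sub (by omega : 1 ≤ n - 1)] at this
        linarith [this]
      have e3 : ((n.choose 3 : ℕ) : ℤ) * 3 = (((n - 1).choose 2 : ℕ) : ℤ) * n := by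
        have h3 : n.choose 3 * 3 = (n - 1).choose 2 * n := by
          have := Nat.add_one_mul_choose_eq (n - 1) 2; rw [show n - 1 + 1 = n from by omega] at this; linarith
        exact_mod_cast h3
      have : ((n.choose 3 : ℕ) : ℤ) * 6 = (((n.choose 3 : ℕ) : ℤ) * 3) * 2 := by ring
      rw [this, e3, mul_assoc, mul_comm (n : ℤ) 2, ← mul_assoc, e2']; ring
    generalize hR1 : ∑ Y ∈ (lev m 1).powersetCard 1, kap 𝒳 𝒵 ∅ (insert d (lev m 1 \ Y)) = R1 at sP ⊢
    generalize hq : (#Qd : ℤ) = q at sP ⊢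
    generalize hε : (#ET : ℤ) = ε at sP ⊢
    generalize hc3 : (cH 3 n : ℤ) = cH3 at sP ⊢
    generalize hC2 : ((n.choose 2 : ℕ) : ℤ) = C2 at sP e2
    generalize hC3 : ((n.choose 3 : ℕ) : ℤ) = C3 at sP e6
    generalize hnz : (n : ℤ) = nz at *
    have hnz6 : (6 : ℤ) ≤ nz := by rw [← hnz]; exact_mod_cast hn6
    have hC2pos : 0 < C2 := by nlinarith [e2]
    have hC3pos : 0 < C3 := by nlinarith [e6]
    have hpos : 0 < C2 * C3 := mul_pos hC2pos hC3pos
    refine le_of_mul_le_mul_left ?_ hpos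
    have eq1 : C2 * C3 * (2 * (nz - 1) * cH3 * q + 6 * (nz + 1) * ε)
        = nz * (nz - 1) * (cH3 * C3 * (q * (nz - 1)) + (nz + 1) * C2 * (ε * (nz - 2))) := by
      linear_combination (C3 * (nz - 1) * cH3 * q) * e2 + (C2 * (nz + 1) * ε) * e6
    have eq2 : C2 * C3 * (nz * (nz - 1) * R1) = nz * (nz - 1) * (C2 * C3 * R1) := by ring
    rw [eq1, eq2]
    exact mul_le_mul_of_nonneg_left sP (by nlinarith)
  · -- the link pieces at d', pinned at d (level 2)
    have hP : ∀ Y ∈ (lev m 1).powersetCard 1,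
        ((cH 2 n * n.choose 2 : ℕ) : ℤ) * #(A1.filter fun w => w ⊆ lev m 1 \ Y)
          + ((cH 1 n * n.choose 1 : ℕ) : ℤ) * #(Qd'.filter fun w => w ⊆ lev m 1 \ Y)
          ≤ ((n.choose 1 * n.choose 2 : ℕ) : ℤ) * kap 𝒳 𝒵 {d'} (insert d (lev m 1 \ Y)) := fun Y hY => by
      have h := pinnedT_le_kap h𝒳 h𝒵 1 n {d'} (insert d (lev m 1 \ Y)) d (disjoint_singleton_left.2 (hd'U Y)) (hnY Y hY)
        (mem_insert_self d _) (by omega) (hl2X _) (hl2Z _)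
      have h1 := card_filter_points_le_pinned (𝒳 := 𝒳) (𝒵 := 𝒵) (s := lev m 1 \ Y) hDe hdT
      have h2 := card_filter_pairs_le_unpinned (𝒳 := 𝒳) (𝒵 := 𝒵) (s := lev m 1 \ Y) (d' := d') hdT
      have m1 := mul_le_mul_of_nonneg_left (show (#(A1.filter fun w => w ⊆ lev m 1 \ Y) : ℤ)
          ≤ #((csetsT 𝒳 𝒵 {d'} (insert d (lev m 1 \ Y)) 2).filter fun w => d ∈ w) by exact_mod_cast h1)
        (show (0 : ℤ) ≤ ((cH 2 n * n.choose 2 : ℕ) : ℤ) from Nat.cast_nonneg _)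
      have m2 := mul_le_mul_of_nonneg_left (show (#(Qd'.filter fun w => w ⊆ lev m 1 \ Y) : ℤ)
          ≤ #((csetsT 𝒳 𝒵 {d'} (insert d (lev m 1 \ Y)) 2).filter fun w => d ∉ w) by exact_mod_cast h2)
        (show (0 : ℤ) ≤ ((cH 1 n * n.choose 1 : ℕ) : ℤ) from Nat.cast_nonneg _)
      linarith
    have hA1' : ∀ w ∈ A1, w ⊆ lev m 1 ∧ #w = 1 := fun w hw => mem_powersetCard.1 (mem_filter.1 hw).1
    have hQd'' : ∀ w ∈ Qd', w ⊆ lev m 1 ∧ #w = 2 := fun w hw => mem_powersetCard.1 (mem_filter.1 hw).1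
    have sP := sum_le_sum hP
    rw [sum_add_distrib, ← mul_sum, ← mul_sum, ← mul_sum] at sP
    rw [show ∑ x ∈ (lev m 1).powersetCard 1, (#(A1.filter fun w => w ⊆ lev m 1 \ x) : ℤ) = (#A1 * (#(lev m 1) - 1).choose 1 : ℕ) from by
      exact_mod_cast sum_card_filter_subset_sdiff hA1' 1] at sP
    rw [show ∑ x ∈ (lev m 1).powersetCard 1, (#(Qd'.filter fun w => w ⊆ lev m 1 \ x) : ℤ) = (#Qd' * (#(lev m 1) - 2).choose 1 : ℕ) from by
      exact_mod_cast sum_card_filter_subset_sdiff hQd'' 1] at sP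
    have hcH2 : cH 2 n = n + 1 := by unfold cH; rw [show min 2 (n + 1 - 2) = 2 from by omega]; simp [sum_range_succ]; omega
    have hcH1 : cH 1 n = 1 := by unfold cH; rw [show min 1 (n + 1 - 1) = 1 from by omega]; simp
    rw [hn, hcH2, hcH1] at sP
    simp only [Nat.choose_one_right, Nat.add_sub_cancel, show n + 1 - 2 = n - 1 from by omega, one_mul] at sP
    push_cast [Nat.cast_sub h1n] at sP
    have e2 : ((n.choose 2 : ℕ) : ℤ) * 2 = (n : ℤ) * (n - 1) := by
      have h2 : n.choose 2 * 2 = n * (n - 1) := by rw [Nat.choose_two_right]; exact Nat.div_mul_cancel (Nat.even_mul_pred_self n).two_dvd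
      have := congrArg (fun k : ℕ => (k : ℤ)) h2; push_cast [Nat.cast_sub h1n] at this; linarith
    generalize hR2 : ∑ Y ∈ (lev m 1).powersetCard 1, kap 𝒳 𝒵 {d'} (insert d (lev m 1 \ Y)) = R2 at sP ⊢
    generalize ha : (#A1 : ℤ) = a at sP ⊢
    generalize hq : (#Qd' : ℤ) = q at sP ⊢
    generalize hC2 : ((n.choose 2 : ℕ) : ℤ) = C2 at sP e2
    generalize hnz : (n : ℤ) = nz at *
    have hnz6 : (6 : ℤ) ≤ nz := by rw [← hnz]; exact_mod_cast hn6
    have hC2pos : 0 < C2 := by nlinarith [e2]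
    refine le_of_mul_le_mul_left ?_ hC2pos
    have eq1 : C2 * (nz * (nz + 1) * a + 2 * q) = (nz + 1) * C2 * (a * nz) + nz * (q * (nz - 1)) := by
      linear_combination q * e2
    have eq2 : C2 * (nz * R2) = nz * C2 * R2 := by ring
    rw [eq1, eq2]
    linarith [sP]

omit [Fintype α] in
/-- **Pinned facts of the LINK cubes of the row `#dbl = 2`** (`n = τ − 1 ≥ 6`; `dbl m = {d, d'}`): the link cube
`κ({d'}, d ∪ (T∖Q))` pinned at `d` (level 2) pays for the set `𝒜` and the `d'`-pairs: `n²·a + 2·q_{d'} ≤ 2·Σ_Q κ`. [this work] -/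
theorem rowTwo_pinned_facts_M (h𝒳 : IsUpperSet (𝒳 : Set (Finset α))) (h𝒵 : IsUpperSet (𝒵 : Set (Finset α)))
    (hX3 : ∀ S ∈ 𝒳, 3 ≤ #S) (hZ3 : ∀ S ∈ 𝒵, 3 ≤ #S) {m : α →₀ ℕ} {d d' : α} (hDe : dbl m = {d, d'}) (hdd' : d ≠ d')
    {n : ℕ} (hn : #(lev m 1) = n + 1) (hn6 : 6 ≤ n) :
    (n : ℤ) ^ 2 * #(((lev m 1).powersetCard 1).filter fun Y => dbl m ∪ Y ∈ 𝒳 ∧ dbl m ∪ Y ∈ 𝒵) +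
        2 * #(((lev m 1).powersetCard 2).filter fun Q => insert d' Q ∈ 𝒳 ∧ insert d' Q ∈ 𝒵) ≤
      2 * ∑ Q ∈ (lev m 1).powersetCard 2, kapL1 𝒳 𝒵 m d Q := by
  unfold kapL1
  have hDT : Disjoint (dbl m) (lev m 1) := disjoint_dbl_lev_one m
  have hd : d ∈ dbl m := by rw [hDe]; simp
  have hd' : d' ∈ dbl m := by rw [hDe]; simp
  have hdT : d ∉ lev m 1 := fun h => disjoint_left.1 hDT hd h
  have hd'T : d' ∉ lev m 1 := fun h => disjoint_left.1 hDT hd' h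
  have he : (dbl m).erase d = {d'} := by
    rw [hDe]; ext i; simp only [mem_erase, mem_insert, mem_singleton]
    constructor
    · rintro ⟨hne, h | h⟩
      · exact absurd h hne
      · exact h
    · rintro rfl; exact ⟨hdd'.symm, Or.inr rfl⟩
  rw [he]
  set A1 := ((lev m 1).powersetCard 1).filter fun Y => dbl m ∪ Y ∈ 𝒳 ∧ dbl m ∪ Y ∈ 𝒵 with hA1
  set Qd' := ((lev m 1).powersetCard 2).filter fun Q => insert d' Q ∈ 𝒳 ∧ insert d' Q ∈ 𝒵 with hQd'
  have h1n : 1 ≤ n := by omega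
  have h2n : 2 ≤ n := by omega
  have hl2X : ∀ s, ∀ U ∈ tr 𝒳 {d'} s, 2 ≤ #U := fun s U hU => by
    have := hX3 _ (mem_tr.1 hU).2; have := card_union_le ({d'} : Finset α) U; rw [card_singleton] at this; omega
  have hl2Z : ∀ s, ∀ U ∈ tr 𝒵 {d'} s, 2 ≤ #U := fun s U hU => by
    have := hZ3 _ (mem_tr.1 hU).2; have := card_union_le ({d'} : Finset α) U; rw [card_singleton] at this; omega
  have hnQ : ∀ Q ∈ (lev m 1).powersetCard 2, #(insert d (lev m 1 \ Q)) = (n - 1) + 1 := fun Q hQ => by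
    rw [card_insert_of_notMem (fun h => hdT (mem_sdiff.1 h).1), card_sdiff_of_subset (mem_powersetCard.1 hQ).1,
      (mem_powersetCard.1 hQ).2]; omega
  have hd'U : ∀ Q, d' ∉ insert d (lev m 1 \ Q) := fun Q h => by
    rcases mem_insert.1 h with h | h
    · exact hdd' h.symm
    · exact hd'T (mem_sdiff.1 h).1
  have hP : ∀ Q ∈ (lev m 1).powersetCard 2,
      ((cH 2 (n - 1) * (n - 1).choose 2 : ℕ) : ℤ) * #(A1.filter fun w => w ⊆ lev m 1 \ Q)
        + ((cH 1 (n - 1) * (n - 1).choose 1 : ℕ) : ℤ) * #(Qd'.filter fun w => w ⊆ lev m 1 \ Q)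
        ≤ (((n - 1).choose 1 * (n - 1).choose 2 : ℕ) : ℤ) * kap 𝒳 𝒵 {d'} (insert d (lev m 1 \ Q)) := fun Q hQ => by
    have h := pinnedT_le_kap h𝒳 h𝒵 1 (n - 1) {d'} (insert d (lev m 1 \ Q)) d (disjoint_singleton_left.2 (hd'U Q)) (hnQ Q hQ)
      (mem_insert_self d _) (by omega) (hl2X _) (hl2Z _)
    have h1 := card_filter_points_le_pinned (𝒳 := 𝒳) (𝒵 := 𝒵) (s := lev m 1 \ Q) hDe hdT
    have h2 := card_filter_pairs_le_unpinned (𝒳 := 𝒳) (𝒵 := 𝒵) (s := lev m 1 \ Q) (d' := d') hdT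
    have m1 := mul_le_mul_of_nonneg_left (show (#(A1.filter fun w => w ⊆ lev m 1 \ Q) : ℤ)
        ≤ #((csetsT 𝒳 𝒵 {d'} (insert d (lev m 1 \ Q)) 2).filter fun w => d ∈ w) by exact_mod_cast h1)
      (show (0 : ℤ) ≤ ((cH 2 (n - 1) * (n - 1).choose 2 : ℕ) : ℤ) from Nat.cast_nonneg _)
    have m2 := mul_le_mul_of_nonneg_left (show (#(Qd'.filter fun w => w ⊆ lev m 1 \ Q) : ℤ)
        ≤ #((csetsT 𝒳 𝒵 {d'} (insert d (lev m 1 \ Q)) 2).filter fun w => d ∉ w) by exact_mod_cast h2)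
      (show (0 : ℤ) ≤ ((cH 1 (n - 1) * (n - 1).choose 1 : ℕ) : ℤ) from Nat.cast_nonneg _)
    linarith
  have hA1' : ∀ w ∈ A1, w ⊆ lev m 1 ∧ #w = 1 := fun w hw => mem_powersetCard.1 (mem_filter.1 hw).1
  have hQd'' : ∀ w ∈ Qd', w ⊆ lev m 1 ∧ #w = 2 := fun w hw => mem_powersetCard.1 (mem_filter.1 hw).1
  have sP := sum_le_sum hP
  rw [sum_add_distrib, ← mul_sum, ← mul_sum, ← mul_sum] at sP
  rw [show ∑ x ∈ (lev m 1).powersetCard 2, (#(A1.filter fun w => w ⊆ lev m 1 \ x) : ℤ) = (#A1 * (#(lev m 1) - 1).choose 2 : ℕ) from by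
    exact_mod_cast sum_card_filter_subset_sdiff hA1' 2] at sP
  rw [show ∑ x ∈ (lev m 1).powersetCard 2, (#(Qd'.filter fun w => w ⊆ lev m 1 \ x) : ℤ) = (#Qd' * (#(lev m 1) - 2).choose 2 : ℕ) from by
    exact_mod_cast sum_card_filter_subset_sdiff hQd'' 2] at sP
  have hcH2 : cH 2 (n - 1) = n := by
    unfold cH; rw [show min 2 (n - 1 + 1 - 2) = 2 from by omega]; simp [sum_range_succ]; omega
  have hcH1 : cH 1 (n - 1) = 1 := by unfold cH; rw [show min 1 (n - 1 + 1 - 1) = 1 from by omega]; simp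
  rw [hn, hcH2, hcH1] at sP
  simp only [Nat.choose_one_right, Nat.add_sub_cancel, show n + 1 - 2 = n - 1 from by omega, one_mul] at sP
  push_cast [Nat.cast_sub h1n] at sP
  have e2 : ((n.choose 2 : ℕ) : ℤ) * 2 = (n : ℤ) * (n - 1) := by
    have h2 : n.choose 2 * 2 = n * (n - 1) := by rw [Nat.choose_two_right]; exact Nat.div_mul_cancel (Nat.even_mul_pred_self n).two_dvd
    have := congrArg (fun k : ℕ => (k : ℤ)) h2; push_cast [Nat.cast_sub h1n] at this; linarith
  have e2' : (((n - 1).choose 2 : ℕ) : ℤ) * 2 = ((n : ℤ) - 1) * (n - 2) := by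
    have h2 : (n - 1).choose 2 * 2 = (n - 1) * (n - 1 - 1) := by
      rw [Nat.choose_two_right]; exact Nat.div_mul_cancel (Nat.even_mul_pred_self _).two_dvd
    have := congrArg (fun k : ℕ => (k : ℤ)) h2
    push_cast [Nat.cast_sub h1n, Nat.cast_sub (by omega : 1 ≤ n - 1)] at this
    linarith [this]
  generalize hM : ∑ Q ∈ (lev m 1).powersetCard 2, kap 𝒳 𝒵 {d'} (insert d (lev m 1 \ Q)) = M at sP ⊢
  generalize ha : (#A1 : ℤ) = a at sP ⊢
  generalize hq : (#Qd' : ℤ) = q at sP ⊢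
  generalize hC2 : ((n.choose 2 : ℕ) : ℤ) = C2 at sP e2
  generalize hC2' : (((n - 1).choose 2 : ℕ) : ℤ) = C2' at sP e2'
  generalize hnz : (n : ℤ) = nz at *
  have hnz6 : (6 : ℤ) ≤ nz := by rw [← hnz]; exact_mod_cast hn6
  have hC2'pos : 0 < C2' := by nlinarith [e2']
  have hpos : 0 < C2' * (nz - 1) := mul_pos hC2'pos (by linarith)
  refine le_of_mul_le_mul_left ?_ hpos
  have eq1 : C2' * (nz - 1) * (nz ^ 2 * a + 2 * q) = 2 * (nz * C2' * (a * C2) + (nz - 1) * (q * C2')) := by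
    linear_combination (-(nz * C2' * a)) * e2
  have eq2 : C2' * (nz - 1) * (2 * M) = 2 * ((nz - 1) * C2' * M) := by ring
  rw [eq1, eq2]
  linarith [sP]

end RowTwoPinned

end Summit.CriticalPhenomena.PercolationContinuityZ3.Theorems.SahiCTCForms
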